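import Summits.Ventures.PercRepro.S2CobasisDisjoint

/-!
# PercRepro — S2: THE COBASIS LEVER, II — THE COBASIS `6`-SETS AT CORANK `6` (p7, gen 6; sub-claim S2)

At corank `6` the top sets' complements are the independent `5`-sets and the `6`-sets `B` of rank `5` whose complement
is a basis (**`ThmN.topCount_le_indep_add_cobasis_six`**). Such a `B` contains a circuit `C`, `3 ≤ |C| ≤ 6`, and is
`C ∪ Q` with `Q ⊆ E ∖ C`, `|Q| = 6 − |C|`; when `C = T` is a triangle and `s₃ ≥ 5`, S2CobasisDisjoint's circuit `D`
(`≤ 4` elements, disjoint from `T`) cannot lie in the independent set `E ∖ B`, so `Q` meets `D`: at most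
`C(n − 3, 3) − C(n − 7, 3)` choices of `Q` (`n = p + 6`). Hence (**`ncard_cobasis_six_le`**)

  `#{B : |B| = 6, r(B) = 5, r(E ∖ B) = p} ≤ s₃·(C(p + 3, 3) − C(p − 1, 3)) + s₄·C(p + 2, 2) + s₅·(p + 1) + s₆`.

At `(20, 6)` (`n = 26`) this is `802` per triangle instead of `1771`. Axioms: standard.
-/

open scoped Matroid

namespace PercRepro

namespace S2

open Set Finset

variable {α : Type} {M : Matroid α}

open scoped Classical in
/-- The circuits with `k` elements, as a finset of finsets: its card is the circuit count `s_k`. -/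
theorem card_circuitsF [M.Finite] (k : ℕ) :
    (((Matroid.groundF M).powersetCard k).filter (fun C : Finset α => M.IsCircuit (C : Set α))).card =
      {C : Set α | M.IsCircuit C ∧ C.ncard = k}.ncard := by
  classical
  set Ef := Matroid.groundF M with hEf
  set Tk : Finset (Finset α) := (Ef.powersetCard k).filter (fun C : Finset α => M.IsCircuit (C : Set α)) with hTkdef
  have hTkmem : ∀ T ∈ Tk, M.IsCircuit (T : Set α) ∧ T.card = k := by
    intro T hT
    rw [hTkdef, Finset.mem_filter, Finset.mem_powersetCard] at hT
    exact ⟨hT.2, hT.1.2⟩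
  rw [← Matroid.card_circF]
  have himg : Matroid.circF M k = Tk.image (fun s : Finset α => (s : Set α)) := by
    ext C
    rw [Matroid.mem_circF, Finset.mem_image]
    constructor
    · rintro ⟨hC, hCk⟩
      have hCfin : C.Finite := M.ground_finite.subset hC.subset_ground
      refine ⟨hCfin.toFinset, ?_, by simp⟩
      rw [hTkdef, Finset.mem_filter, Finset.mem_powersetCard]
      refine ⟨⟨?_, ?_⟩, by simpa using hC⟩
      · intro x hx
        rw [Set.Finite.mem_toFinset] at hx
        rw [hEf, Matroid.groundF, Set.Finite.mem_toFinset]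
        exact hC.subset_ground hx
      · rw [← Set.ncard_eq_toFinset_card C hCfin]; exact hCk
    · rintro ⟨s, hs, rfl⟩
      obtain ⟨hsc, hsk⟩ := hTkmem s hs
      exact ⟨hsc, by rw [Set.ncard_coe_finset]; exact hsk⟩
  rw [himg, Finset.card_image_of_injective _ Finset.coe_injective]

open scoped Classical in
/-- **Lemma B — the cobasis count at corank `6`**: the rank-`5` sets `B` with `6` elements whose complement has rank
`p = |E| − 6` (a basis). Each contains a circuit `C` with `3 ≤ |C| ≤ 6` and is `C ∪ Q`, `Q ⊆ E ∖ C`, `|Q| = 6 − |C|`;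
when `C = T` is a triangle and `s₃ ≥ 5`, Lemma A's circuit `D` (`≤ 4` elements, disjoint from `T`) cannot lie in the
independent set `E ∖ B`, so `Q` meets `D`: at most `C(n − 3, 3) − C(n − 7, 3)` choices of `Q` (`n = p + 6`). -/
theorem ncard_cobasis_six_le [M.Finite] (hC1 : ∀ L ⊆ M.E, M.eRk L = 2 → L.ncard ≤ 3)
    (hcirc : ∀ C, M.IsCircuit C → 3 ≤ C.encard) {p : ℕ} (hn : M.E.ncard = p + 6)
    (h5 : 5 ≤ {C : Set α | M.IsCircuit C ∧ C.ncard = 3}.ncard) :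
    {B : Set α | B ⊆ M.E ∧ M.eRk B = 5 ∧ B.ncard = 6 ∧ M.eRk (M.E \ B) = (p : ℕ∞)}.ncard ≤
      {C : Set α | M.IsCircuit C ∧ C.ncard = 3}.ncard * ((p + 3).choose 3 - (p - 1).choose 3) +
      {C : Set α | M.IsCircuit C ∧ C.ncard = 4}.ncard * (p + 2).choose 2 +
      {C : Set α | M.IsCircuit C ∧ C.ncard = 5}.ncard * (p + 1) +
      {C : Set α | M.IsCircuit C ∧ C.ncard = 6}.ncard := by
  classical
  set Ef := Matroid.groundF M with hEf
  have hE : (Ef : Set α) = M.E := Matroid.coe_groundF M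
  have hEcard : Ef.card = p + 6 := by rw [hEf, Matroid.card_groundF, hn]
  -- the circuit families
  set Tk : ℕ → Finset (Finset α) :=
    fun k => (Ef.powersetCard k).filter (fun C : Finset α => M.IsCircuit (C : Set α)) with hTk
  have hTkmem : ∀ k, ∀ C ∈ Tk k, M.IsCircuit (C : Set α) ∧ C.card = k ∧ C ⊆ Ef := by
    intro k C hC
    simp only [hTk, Finset.mem_filter, Finset.mem_powersetCard] at hC
    exact ⟨hC.2, hC.1.2, hC.1.1⟩
  have hTkcard : ∀ k, (Tk k).card = {C : Set α | M.IsCircuit C ∧ C.ncard = k}.ncard :=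
    fun k => card_circuitsF k
  -- Lemma A: a disjoint circuit with `≤ 4` elements for every triangle, as a finset inside `Ef`
  have hA : ∀ T ∈ Tk 3, ∃ D : Finset α, M.IsCircuit (D : Set α) ∧ D.card ≤ 4 ∧ Disjoint D T ∧ D ⊆ Ef := by
    intro T hT
    have h5' : 5 ≤ (Tk 3).card := by rw [hTkcard 3]; exact h5
    obtain ⟨C, hC, hC4, hCT⟩ := exists_circuit_le_four_disjoint_of_five_triangles hC1 (Tk 3)
      (fun T hT => ⟨(hTkmem 3 T hT).1, (hTkmem 3 T hT).2.1⟩) h5' hT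
    have hCfin : C.Finite := M.ground_finite.subset hC.subset_ground
    refine ⟨hCfin.toFinset, by simpa using hC, ?_, ?_, ?_⟩
    · rw [← Set.ncard_eq_toFinset_card C hCfin]; exact hC4
    · rw [← Finset.disjoint_coe, Set.Finite.coe_toFinset]; exact hCT
    · intro x hx
      rw [Set.Finite.mem_toFinset] at hx
      rw [hEf, Matroid.groundF, Set.Finite.mem_toFinset]
      exact hC.subset_ground hx
  choose D hD using hA
  let Dt : Finset α → Finset α := fun T => if h : T ∈ Tk 3 then D T h else ∅
  -- the pairs `(C, Q)`
  set P3 : Finset (Σ _ : Finset α, Finset α) :=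
    (Tk 3).sigma (fun T => ((Ef \ T).powersetCard 3).filter (fun Q => (Q ∩ Dt T).Nonempty)) with hP3
  set Pk : ℕ → Finset (Σ _ : Finset α, Finset α) :=
    fun k => (Tk k).sigma (fun C => (Ef \ C).powersetCard (6 - k)) with hPk
  have hP3card : P3.card ≤ (Tk 3).card * ((p + 3).choose 3 - (p - 1).choose 3) := by
    rw [hP3, Finset.card_sigma]
    have hbound : ∀ T ∈ Tk 3,
        (((Ef \ T).powersetCard 3).filter (fun Q => (Q ∩ Dt T).Nonempty)).card ≤
          (p + 3).choose 3 - (p - 1).choose 3 := by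
      intro T hT
      obtain ⟨hTc, hT3, hTE⟩ := hTkmem 3 T hT
      obtain ⟨hDc, hD4, hDT, hDE⟩ := hD T hT
      have hDt : Dt T = D T hT := by simp only [Dt, dif_pos hT]
      have hcompl : ((Ef \ T).powersetCard 3).filter (fun Q => ¬ (Q ∩ Dt T).Nonempty) =
          ((Ef \ T) \ Dt T).powersetCard 3 := by
        ext Q
        simp only [Finset.mem_filter, Finset.mem_powersetCard, Finset.not_nonempty_iff_eq_empty]
        constructor
        · rintro ⟨⟨hQ, hQ3⟩, hQD⟩
          refine ⟨fun x hx => ?_, hQ3⟩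
          rw [Finset.mem_sdiff]
          refine ⟨hQ hx, fun hxD => ?_⟩
          have hxQD : x ∈ Q ∩ Dt T := Finset.mem_inter.2 ⟨hx, hxD⟩
          rw [hQD] at hxQD
          exact Finset.notMem_empty x hxQD
        · rintro ⟨hQ, hQ3⟩
          refine ⟨⟨hQ.trans Finset.sdiff_subset, hQ3⟩, ?_⟩
          rw [Finset.eq_empty_iff_forall_notMem]
          intro x hx
          rw [Finset.mem_inter] at hx
          exact (Finset.mem_sdiff.1 (hQ hx.1)).2 hx.2
      have hsplit := Finset.card_filter_add_card_filter_not
        (s := (Ef \ T).powersetCard 3) (fun Q => (Q ∩ Dt T).Nonempty)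
      rw [hcompl, Finset.card_powersetCard, Finset.card_powersetCard] at hsplit
      have hEfT : (Ef \ T).card = p + 3 := by
        rw [Finset.card_sdiff, Finset.inter_eq_left.2 hTE, hEcard, hT3]
        omega
      have hEfTD : p - 1 ≤ ((Ef \ T) \ Dt T).card := by
        rw [Finset.card_sdiff, hEfT]
        have : (Dt T ∩ (Ef \ T)).card ≤ 4 :=
          (Finset.card_le_card Finset.inter_subset_left).trans (by rw [hDt]; exact hD4)
        omega
      have hmono := Nat.choose_le_choose 3 hEfTD
      rw [hEfT] at hsplit
      omega
    calc ∑ T ∈ Tk 3, (((Ef \ T).powersetCard 3).filter (fun Q => (Q ∩ Dt T).Nonempty)).card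
        ≤ ∑ T ∈ Tk 3, ((p + 3).choose 3 - (p - 1).choose 3) := Finset.sum_le_sum hbound
      _ = (Tk 3).card * ((p + 3).choose 3 - (p - 1).choose 3) := by
        rw [Finset.sum_const, smul_eq_mul]
  have hPkcard : ∀ k, k ≤ 6 → (Pk k).card = (Tk k).card * (p + 6 - k).choose (6 - k) := by
    intro k hk6
    rw [hPk, Finset.card_sigma]
    have : ∀ C ∈ Tk k, ((Ef \ C).powersetCard (6 - k)).card = (p + 6 - k).choose (6 - k) := by
      intro C hC
      obtain ⟨_, hCk, hCE⟩ := hTkmem k C hC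
      rw [Finset.card_powersetCard, Finset.card_sdiff, Finset.inter_eq_left.2 hCE, hEcard, hCk]
    rw [Finset.sum_congr rfl this, Finset.sum_const, smul_eq_mul]
  -- the cobasis `6`-sets, as finsets
  set U6 : Finset (Finset α) := (Ef.powersetCard 6).filter
    (fun B : Finset α => M.eRk (B : Set α) = 5 ∧ M.eRk (M.E \ (B : Set α)) = (p : ℕ∞)) with hU6
  -- every member is the union of one of the pairs
  have hcover : U6 ⊆ P3.image (fun x => x.1 ∪ x.2) ∪ (Pk 4).image (fun x => x.1 ∪ x.2) ∪
      (Pk 5).image (fun x => x.1 ∪ x.2) ∪ (Pk 6).image (fun x => x.1 ∪ x.2) := by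
    intro B hB
    rw [hU6, Finset.mem_filter, Finset.mem_powersetCard] at hB
    obtain ⟨⟨hBE, hB6⟩, hBr, hBc⟩ := hB
    have hBE' : (B : Set α) ⊆ M.E := by rw [← hE]; exact Finset.coe_subset.2 hBE
    -- `B` is dependent
    have hBdep : M.Dep (B : Set α) := by
      rw [Matroid.dep_iff]
      refine ⟨fun hind => ?_, hBE'⟩
      rw [hind.eRk_eq_encard, Set.encard_coe_eq_coe_finsetCard, hB6] at hBr
      exact absurd hBr (by decide)
    obtain ⟨C, hCB, hC⟩ := hBdep.exists_isCircuit_subset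
    have hCfin : C.Finite := (Finset.finite_toSet B).subset hCB
    set Cf := hCfin.toFinset with hCf
    have hCfB : Cf ⊆ B := by
      intro x hx
      rw [hCf, Set.Finite.mem_toFinset] at hx
      exact Finset.mem_coe.1 (hCB hx)
    have hCfc : M.IsCircuit (Cf : Set α) := by rw [hCf, Set.Finite.coe_toFinset]; exact hC
    have hCf3 : 3 ≤ Cf.card := by
      have h := hcirc C hC
      rw [← hCfin.cast_ncard_eq, Set.ncard_eq_toFinset_card C hCfin] at h
      exact_mod_cast h
    have hCf6 : Cf.card ≤ 6 := hB6 ▸ Finset.card_le_card hCfB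
    have hCfE : Cf ⊆ Ef := hCfB.trans hBE
    have hmemTk : Cf ∈ Tk Cf.card := by
      rw [hTk]
      exact Finset.mem_filter.2 ⟨Finset.mem_powersetCard.2 ⟨hCfE, rfl⟩, hCfc⟩
    have hunion : Cf ∪ (B \ Cf) = B := Finset.union_sdiff_of_subset hCfB
    have hQ : B \ Cf ∈ (Ef \ Cf).powersetCard (6 - Cf.card) := by
      rw [Finset.mem_powersetCard]
      refine ⟨Finset.sdiff_subset_sdiff hBE le_rfl, ?_⟩
      rw [Finset.card_sdiff, Finset.inter_eq_left.2 hCfB, hB6]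
    rcases (show Cf.card = 3 ∨ Cf.card = 4 ∨ Cf.card = 5 ∨ Cf.card = 6 by omega) with h3 | h4 | h5' | h6
    · -- a triangle: `Q = B ∖ T` must meet Lemma A's circuit `D`
      rw [h3] at hmemTk hQ
      refine Finset.mem_union.2 (Or.inl (Finset.mem_union.2 (Or.inl (Finset.mem_union.2 (Or.inl ?_)))))
      rw [Finset.mem_image]
      refine ⟨⟨Cf, B \ Cf⟩, ?_, hunion⟩
      rw [hP3]
      refine Finset.mem_sigma.2 ⟨hmemTk, Finset.mem_filter.2 ⟨hQ, ?_⟩⟩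
      obtain ⟨hDc, hD4, hDT, hDE⟩ := hD Cf hmemTk
      have hDt : Dt Cf = D Cf hmemTk := by simp only [Dt, dif_pos hmemTk]
      rw [hDt]
      by_contra hemp
      rw [Finset.not_nonempty_iff_eq_empty] at hemp
      -- `D ⊆ E ∖ B`
      have hDsub : ((D Cf hmemTk : Finset α) : Set α) ⊆ M.E \ (B : Set α) := by
        intro x hx
        rw [Finset.mem_coe] at hx
        refine ⟨by rw [← hE]; exact Finset.mem_coe.2 (hDE hx), fun hxB => ?_⟩
        rw [Finset.mem_coe] at hxB
        have hxC : x ∉ Cf := Finset.disjoint_left.1 hDT hx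
        have hx' : x ∈ (B \ Cf) ∩ D Cf hmemTk :=
          Finset.mem_inter.2 ⟨Finset.mem_sdiff.2 ⟨hxB, hxC⟩, hx⟩
        rw [hemp] at hx'
        exact Finset.notMem_empty x hx'
      -- `E ∖ B` is independent: `p` elements of rank `p`
      have hind : M.Indep (M.E \ (B : Set α)) := by
        have hfin : (M.E \ (B : Set α)).Finite := M.ground_finite.sdiff
        rw [Matroid.indep_iff_eRk_eq_encard_of_finite hfin, hBc, ← hfin.cast_ncard_eq,
          Set.ncard_sdiff hBE' (Finset.finite_toSet B), hn, Set.ncard_coe_finset, hB6]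
        norm_num
      exact hDc.not_indep (hind.subset hDsub)
    · rw [h4] at hmemTk hQ
      refine Finset.mem_union.2 (Or.inl (Finset.mem_union.2 (Or.inl (Finset.mem_union.2 (Or.inr ?_)))))
      rw [Finset.mem_image]
      exact ⟨⟨Cf, B \ Cf⟩, by rw [hPk]; exact Finset.mem_sigma.2 ⟨hmemTk, hQ⟩, hunion⟩
    · rw [h5'] at hmemTk hQ
      refine Finset.mem_union.2 (Or.inl (Finset.mem_union.2 (Or.inr ?_)))
      rw [Finset.mem_image]
      exact ⟨⟨Cf, B \ Cf⟩, by rw [hPk]; exact Finset.mem_sigma.2 ⟨hmemTk, hQ⟩, hunion⟩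
    · rw [h6] at hmemTk hQ
      refine Finset.mem_union.2 (Or.inr ?_)
      rw [Finset.mem_image]
      exact ⟨⟨Cf, B \ Cf⟩, by rw [hPk]; exact Finset.mem_sigma.2 ⟨hmemTk, hQ⟩, hunion⟩
  have hU6card : U6.card ≤ P3.card + (Pk 4).card + (Pk 5).card + (Pk 6).card := by
    calc U6.card
        ≤ (P3.image (fun x => x.1 ∪ x.2) ∪ (Pk 4).image (fun x => x.1 ∪ x.2) ∪
            (Pk 5).image (fun x => x.1 ∪ x.2) ∪ (Pk 6).image (fun x => x.1 ∪ x.2)).card :=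
          Finset.card_le_card hcover
      _ ≤ (P3.image (fun x => x.1 ∪ x.2) ∪ (Pk 4).image (fun x => x.1 ∪ x.2) ∪
            (Pk 5).image (fun x => x.1 ∪ x.2)).card + ((Pk 6).image (fun x => x.1 ∪ x.2)).card :=
          Finset.card_union_le _ _
      _ ≤ (P3.image (fun x => x.1 ∪ x.2) ∪ (Pk 4).image (fun x => x.1 ∪ x.2)).card +
            ((Pk 5).image (fun x => x.1 ∪ x.2)).card + ((Pk 6).image (fun x => x.1 ∪ x.2)).card := by
          gcongr
          exact Finset.card_union_le _ _
      _ ≤ (P3.image (fun x => x.1 ∪ x.2)).card + ((Pk 4).image (fun x => x.1 ∪ x.2)).card +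
            ((Pk 5).image (fun x => x.1 ∪ x.2)).card + ((Pk 6).image (fun x => x.1 ∪ x.2)).card := by
          gcongr
          exact Finset.card_union_le _ _
      _ ≤ P3.card + (Pk 4).card + (Pk 5).card + (Pk 6).card := by
          gcongr <;> exact Finset.card_image_le
  -- the sets of sets, as the finset `U6`
  have hU6set : {B : Set α | B ⊆ M.E ∧ M.eRk B = 5 ∧ B.ncard = 6 ∧ M.eRk (M.E \ B) = (p : ℕ∞)}.ncard =
      U6.card := by
    have himg : {B : Set α | B ⊆ M.E ∧ M.eRk B = 5 ∧ B.ncard = 6 ∧ M.eRk (M.E \ B) = (p : ℕ∞)} =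
        U6.image (fun s : Finset α => (s : Set α)) := by
      ext B
      rw [Set.mem_setOf_eq, Finset.coe_image, Set.mem_image]
      constructor
      · rintro ⟨hBE, hBr, hB6, hBc⟩
        have hBfin : B.Finite := M.ground_finite.subset hBE
        refine ⟨hBfin.toFinset, ?_, by simp⟩
        rw [Finset.mem_coe, hU6, Finset.mem_filter, Finset.mem_powersetCard]
        refine ⟨⟨?_, ?_⟩, ?_, ?_⟩
        · intro x hx
          rw [Set.Finite.mem_toFinset] at hx
          rw [hEf, Matroid.groundF, Set.Finite.mem_toFinset]
          exact hBE hx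
        · rw [← Set.ncard_eq_toFinset_card B hBfin]; exact hB6
        · rw [Set.Finite.coe_toFinset]; exact hBr
        · rw [Set.Finite.coe_toFinset]; exact hBc
      · rintro ⟨s, hs, rfl⟩
        rw [Finset.mem_coe, hU6, Finset.mem_filter, Finset.mem_powersetCard] at hs
        refine ⟨by rw [← hE]; exact Finset.coe_subset.2 hs.1.1, hs.2.1, ?_, hs.2.2⟩
        rw [Set.ncard_coe_finset]; exact hs.1.2
    rw [himg, Finset.coe_image, Set.ncard_image_of_injective _ Finset.coe_injective, Set.ncard_coe_finset]
  rw [hU6set, ← hTkcard 3, ← hTkcard 4, ← hTkcard 5, ← hTkcard 6]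
  have h4 := hPkcard 4 (by norm_num)
  have h5c := hPkcard 5 (by norm_num)
  have h6 := hPkcard 6 (by norm_num)
  rw [show p + 6 - 4 = p + 2 by omega, show (6 : ℕ) - 4 = 2 by norm_num] at h4
  rw [show p + 6 - 5 = p + 1 by omega, show (6 : ℕ) - 5 = 1 by norm_num, Nat.choose_one_right] at h5c
  rw [show p + 6 - 6 = p by omega, show (6 : ℕ) - 6 = 0 by norm_num, Nat.choose_zero_right, mul_one] at h6
  omega

end S2

namespace ThmN

open Set

variable {α : Type}

/-- **`U(p, 5)` at corank `6`, by complements**: `A ↦ E ∖ A` injects the top sets into the rank-`5` sets `B` whose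
complement has rank `p`; `B` has `≤ 6` elements (its complement has `≥ p`) and `≥ 5` (its rank), so it is an
independent `5`-set or a cobasis `6`-set. -/
theorem topCount_le_indep_add_cobasis_six (M : Matroid α) [M.Finite] (p : ℕ)
    (hn : M.E.ncard = p + 6) :
    Matroid.topCount M p 5 ≤ {B : Set α | B ⊆ M.E ∧ B.ncard = 5 ∧ M.eRk B = 5}.ncard +
      {B : Set α | B ⊆ M.E ∧ M.eRk B = 5 ∧ B.ncard = 6 ∧ M.eRk (M.E \ B) = (p : ℕ∞)}.ncard := by
  classical
  set S₁ := {B : Set α | B ⊆ M.E ∧ B.ncard = 5 ∧ M.eRk B = 5} with hS₁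
  set S₂ := {B : Set α | B ⊆ M.E ∧ M.eRk B = 5 ∧ B.ncard = 6 ∧ M.eRk (M.E \ B) = (p : ℕ∞)} with hS₂
  set A₀ := {A : Set α | A ⊆ M.E ∧ M.eRk A = (p : ℕ∞) ∧ M.eRk (M.E \ A) = ((5 : ℕ) : ℕ∞)} with hA₀
  have hmaps : ∀ A ∈ A₀, M.E \ A ∈ S₁ ∪ S₂ := by
    intro A hA
    obtain ⟨hAE, hAr, hAc⟩ := hA
    have hAfin : A.Finite := M.ground_finite.subset hAE
    have hBfin : (M.E \ A).Finite := M.ground_finite.sdiff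
    have hcompl : M.E \ (M.E \ A) = A := Set.sdiff_sdiff_cancel_left hAE
    -- `|A| ≥ r(A) = p`, so `|E ∖ A| ≤ 6`; and `|E ∖ A| ≥ r(E ∖ A) = 5`
    have hAcard : p ≤ A.ncard := by
      have h := M.eRk_le_encard A
      rw [hAr, ← hAfin.cast_ncard_eq] at h
      exact_mod_cast h
    have hBcard : (M.E \ A).ncard = p + 6 - A.ncard := by
      rw [Set.ncard_sdiff hAE hAfin, hn]
    have hB5 : 5 ≤ (M.E \ A).ncard := by
      have h := M.eRk_le_encard (M.E \ A)
      rw [hAc, ← hBfin.cast_ncard_eq] at h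
      exact_mod_cast h
    have hB6 : (M.E \ A).ncard ≤ 6 := by omega
    rcases (show (M.E \ A).ncard = 5 ∨ (M.E \ A).ncard = 6 by omega) with h | h
    · exact Or.inl ⟨Set.sdiff_subset, h, by simpa using hAc⟩
    · exact Or.inr ⟨Set.sdiff_subset, by simpa using hAc, h, by rw [hcompl]; exact hAr⟩
  have hinj : InjOn (fun A => M.E \ A) A₀ := by
    intro A hA A' hA' h
    simp only at h
    rw [← Set.sdiff_sdiff_cancel_left hA.1, h, Set.sdiff_sdiff_cancel_left hA'.1]
  have hfin : (S₁ ∪ S₂).Finite :=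
    M.ground_finite.finite_subsets.subset (fun B hB => by rcases hB with hB | hB <;> exact hB.1)
  unfold Matroid.topCount
  calc A₀.ncard ≤ (S₁ ∪ S₂).ncard := ncard_le_ncard_of_injOn (fun A => M.E \ A) hmaps hinj hfin
    _ ≤ S₁.ncard + S₂.ncard := Set.ncard_union_le _ _

end ThmN

end PercRepro
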